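import Summits.MatrixMultiplication.MatrixMultiplication.Theorems.AbelianSTPPCensusShapeCertVQDefs
import Summits.MatrixMultiplication.MatrixMultiplication.Theorems.AbelianSTPPCensusShapeCertVPSemantics

/-!
# Abelian STPP census — soundness of `ShapeCertVQ` (part 1: record fields; heredity of the E3⁺ condition)

Cell mm-stpp, rung F-M1; successor kernel item VQ-CERT in support of the closed crux item stmt-MatrixMultiplication-19191; seat
mm-stpp-vp-p2 (gen 1).  The checker and its semantic vocabulary (`AdmE`, `gsumQ`, the triple-level fields with the extended gains)
are defined in `…ShapeCertVQDefs`; the letter-form identities, rule U11-G in credit form (`ShapeCertVP.AdmG`, `AdmG.mono`) and the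
Grynkiewicz weight inequalities are theory g6's (`…ShapeCertVPSemantics`), reused as is.  This file proves:
* the field equations of `shQ` (verbatim after `ShapeCertVP.shV_*`);
* `AdmE.mono` — HEREDITY of the E3⁺ condition: it passes to sub-multisets of a family inside the universe (each member keeps its
  volume, its off-member packing sums only shrink, and `STPPThreeRoomEnergy.e3pLHS` is monotone in them — eng-2 g5's
  `e3pLHS_mono`, p519811);
* `erase_sum_le` — the off-member sums of a sub-multiset are dominated by those of the family (the arithmetic behind both
  `AdmE.mono` and the soundness of the node kill `killE`, `…ShapeCertVQBounds`).
-/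

set_option linter.dupNamespace false -- `MatrixMultiplication.MatrixMultiplication` (summit = problem, D-0017)
set_option autoImplicit false

namespace Summit.MatrixMultiplication.MatrixMultiplication.Theorems.ShapeCertVQ

open ShapeCert ShapeCertVP STPPThreeRoomEnergy Multiset

section fields
/-! ### Fields of the record of a triple -/
variable (M : ℕ) (x : ℕ × ℕ × ℕ)

/-- the record of a triple has that triple -/
@[simp] theorem shQ_tr : (shQ M x).tr = x := by rcases x with ⟨a, b, c⟩; rfl
/-- field `a` -/
@[simp] theorem shQ_a : (shQ M x).a = x.1 := rfl
/-- field `b` -/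
@[simp] theorem shQ_b : (shQ M x).b = x.2.1 := rfl
/-- field `c` -/
@[simp] theorem shQ_c : (shQ M x).c = x.2.2 := rfl
/-- field `V` -/
@[simp] theorem shQ_V : (shQ M x).V = vol x := rfl
/-- field `ab` -/
@[simp] theorem shQ_ab : (shQ M x).ab = pab x := rfl
/-- field `bc` -/
@[simp] theorem shQ_bc : (shQ M x).bc = pbc x := rfl
/-- field `ca` -/
@[simp] theorem shQ_ca : (shQ M x).ca = pca x := rfl
/-- field `wA` -/
@[simp] theorem shQ_wA : (shQ M x).wA = wa x := rfl
/-- field `wB` -/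
@[simp] theorem shQ_wB : (shQ M x).wB = wb x := rfl
/-- field `wC` -/
@[simp] theorem shQ_wC : (shQ M x).wC = wc x := rfl
/-- field `g` -/
@[simp] theorem shQ_g : (shQ M x).g = gTQ x := rfl
/-- field `mpp` -/
@[simp] theorem shQ_mpp : (shQ M x).mpp = mpp3 x := rfl
/-- field `rho` -/
@[simp] theorem shQ_rho : (shQ M x).rho = rhoTQ x := rfl
/-- field `lev` -/
@[simp] theorem shQ_lev : (shQ M x).lev = levTQ x := rfl
/-- field `dab` -/
theorem shQ_dab : (shQ M x).dab = vol x - pab x + (if hasLCD (vol x) M x.2.2 then 0 else 1) := rfl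
/-- field `dbc` -/
theorem shQ_dbc : (shQ M x).dbc = vol x - pbc x + (if hasLCD (vol x) M x.1 then 0 else 1) := rfl
/-- field `dca` -/
theorem shQ_dca : (shQ M x).dca = vol x - pca x + (if hasLCD (vol x) M x.2.1 then 0 else 1) := rfl
/-- the weight of a record is the weight of its triple -/
@[simp] theorem wh_shQ (t : ℕ) : wh t (shQ M x) = whT x t := by
  unfold wh whT mn3; simp [uu]
/-- the ratio of a record is the ratio of its triple -/
@[simp] theorem qh_shQ (t : ℕ) : qh t (shQ M x) = qhTQ x t := by unfold qh qhTQ; simp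
/-- middle letter of a record -/
@[simp] theorem midOf_shQ (r : ℕ) : midOf r (shQ M x) = midT r x := by
  match r with
  | 0 => rfl
  | 1 => rfl
  | _ + 2 => rfl
/-- other-letters product of a record -/
@[simp] theorem xzOf_shQ (r : ℕ) : xzOf r (shQ M x) = xzT r x := by
  match r with
  | 0 => rfl
  | 1 => rfl
  | _ + 2 => rfl
/-- smaller other letter of a record -/
@[simp] theorem mnxzOf_shQ (r : ℕ) : mnxzOf r (shQ M x) = mnxzT r x := by
  match r with
  | 0 => rfl
  | 1 => rfl
  | _ + 2 => rfl
/-- the record does not depend on the order except in the tightness offsets: level -/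
theorem levTQ_eq_lev (M' : ℕ) : (shQ M' x).lev = (shQ M x).lev := rfl

end fields

section admE
/-! ### The E3⁺ condition on multisets: heredity -/

variable {M : ℕ}

/-- off-member sums shrink with the multiset: for `F ≤ G` and any `x`, `Σ_{F ∖ x} f ≤ Σ_{G ∖ x} f` -/
theorem erase_sum_le {F G : Multiset (ℕ × ℕ × ℕ)} (hF : F ≤ G) (x : ℕ × ℕ × ℕ) (f : ℕ × ℕ × ℕ → ℕ) :
    ((F.erase x).map f).sum ≤ ((G.erase x).map f).sum :=
  sum_map_le_of_le (Multiset.erase_le_erase x hF) f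

/-- a universe shape has positive sides and volume at most the order -/
theorem InUniv.sides_vol {x : ℕ × ℕ × ℕ} (h : InUniv M x) :
    1 ≤ x.1 ∧ 1 ≤ x.2.1 ∧ 1 ≤ x.2.2 ∧ x.1 * x.2.1 * x.2.2 ≤ M := by
  obtain ⟨h1, h2, h3⟩ := h.pos
  have hv := h.vol_le
  unfold vol at hv
  exact ⟨h1, h2, h3, le_trans (Nat.le_add_right _ _) hv⟩

/-- **Heredity of the E3⁺ condition**: it passes to sub-multisets (of a family inside the universe of order `M`). -/
theorem AdmE.mono {F G : Multiset (ℕ × ℕ × ℕ)} (h : AdmE M G) (hU : ∀ x ∈ G, InUniv M x) (hF : F ≤ G) : AdmE M F := by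
  intro x hx h2
  have hxG : x ∈ G := Multiset.mem_of_le hF hx
  obtain ⟨p1, p2, p3, hV⟩ := InUniv.sides_vol (hU x hxG)
  exact le_trans (e3pLHS_mono p1 p2 p3 hV (erase_sum_le hF x pbc) (erase_sum_le hF x pca) (erase_sum_le hF x pab))
    (h x hxG h2)

end admE

end Summit.MatrixMultiplication.MatrixMultiplication.Theorems.ShapeCertVQ
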